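import Summits.BirchSwinnertonDyer.BirchSwinnertonDyer.Theorems.TeichmullerTwistDescentKOfHeckeProjector
import Literature.NumberTheory.ModularSymbols.FullLevelHomologyHeckeProjectorInt
import HarnessLib

/-!
# Route `TeichmullerTwistDescent`, crux K `TwistedPeriodLatticeSaturation` (stmt-BirchSwinnertonDyer-25368):
# K, LITERALLY, from modularity + an INTEGRAL Hecke quasi-projector for `f_E` on `H₁(X₀(N), ℤ)` + the tame-type carrier functional

Cell `pub/bsd-wall` (D-0145 line route-BirchSwinnertonDyer-TeichmullerTwistDescent, OPEN rev 7), seat `bsd-line-ttd-p1`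
(prover 1/2, g24).  THEOREMS ONLY (no definition, no named fact, no `sorry`).  BSD is not proved by this file; K is NOT
proved by this file: the main theorem is CONDITIONAL, with the route decl `TwistedPeriodLatticeSaturation` verbatim as its
conclusion.  Compared with `TeichmullerTwistDescentKOfHeckeProjector`, the Hecke hypothesis is now stated on the INTEGRAL
homology `Λ_N = H₁(X₀(N), ℤ)` (`periodHomologyHecke N`) with the Hecke ring `𝕋 = HeckeRing0 N 2` and the period map
`per_f = periodMapLattice N f : Λ_N ↠ Λ_f`, independently of `p`-adic coefficients and of the full-level carrier:

* `hprojZ` — for an elliptic curve of conductor `N`, its modular parametrisation datum `D` (newform `f = D.f`) and a prime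
  `p ≥ 11` with `p² ∣ N`: there are `θ₀ ∈ ℤ[T_q : q ≠ p prime] ⊂ 𝕋` and `c ∈ ℤ ∖ {0}` with `θ₀ · ker(per_f) = 0` and
  `per_f(θ₀ x) = c · per_f(x)` — the integral Hecke quasi-projector `c·e_f` onto the `f`-part (Hecke algebra `⊗ ℚ`
  commutative semisimple; `λ_f`-eigenspace of `{T_q}_{q ∤ pN}` = the `f`-part by strong multiplicity one).

The base change to `H(N; ℤ_p)` is `Literature.…FullLevelHomologyHeckeProjectorInt.multOneHyp_of_intHeckeProjector` (right
exactness of `ℤ_p ⊗ −`).  REMAINING INPUTS of the K-line after this file: `hprojZ` (cite-level Hecke theory), `hcar` (the integral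
tame-type carrier functional — the load-bearing open input), `hnf` (modularity).
-/

set_option linter.dupNamespace false

noncomputable section

open scoped Pointwise MatrixGroups TensorProduct

open Function CongruenceSubgroup
open Literature.RepresentationTheory.FiniteGroups Literature.RepresentationTheory.FiniteGroups.GL2
  Literature.NumberTheory.EllipticCurves.ModularForms
open Literature.NumberTheory.EllipticCurves (Kato2004.teichmullerChar)
open Literature.NumberTheory.ModularSymbols Literature.NumberTheory.ModularSymbols.FullLevel
open Literature.Algebra.Homology

namespace Summit.BirchSwinnertonDyer.BirchSwinnertonDyer.Theorems.TeichmullerTwistDescent.KOfIntHeckeProjector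

open WeierstrassCurve Literature.NumberTheory.EllipticCurves
  Summit.BirchSwinnertonDyer.BirchSwinnertonDyer.Theorems.TeichmullerTwistDescent.CarrierKnapp
  Summit.BirchSwinnertonDyer.BirchSwinnertonDyer.Theorems.TeichmullerTwistDescent.CarrierMultOne
  Summit.BirchSwinnertonDyer.BirchSwinnertonDyer.Theorems.TeichmullerTwistDescent.KOfCarrier
  Summit.BirchSwinnertonDyer.BirchSwinnertonDyer.Theorems.TeichmullerTwistDescent.KOfHeckeProjector

variable (p M : ℕ) [hp : Fact p.Prime] [NeZero M] [NeZero (p ^ 2 * M)] (hpM : Nat.Coprime p M)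
  [Fintype (diagTorus (ZMod p))] [Invertible (Fintype.card (diagTorus (ZMod p)) : ℤ_[p])]

/-- **`MultOneHyp ℤ_p p M hpM f` from an INTEGRAL Hecke quasi-projector on `H₁(X₀(p²M), ℤ)`** (`p ≥ 5`).
[cite: Shimura1971, Thm. 3.41 and Thm. 3.51; CremonaAlgorithms1997, §2.10] -/
theorem multOneHyp_of_intHeckeProjector_padicInt (hp5 : 5 ≤ p) (f : CuspForm (Gamma0 (p ^ 2 * M)) 2)
    {θ₀ : HeckeRing0 (p ^ 2 * M) 2} (hθ₀ : θ₀ ∈ Algebra.adjoin ℤ (heckeIntGenSet (p ^ 2 * M) p)) {c : ℤ} (hc : c ≠ 0)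
    (hkill₀ : ∀ x : periodHomologyHecke (p ^ 2 * M), periodMapLattice (p ^ 2 * M) f x = 0 → θ₀ • x = 0)
    (hscale₀ : ∀ x : periodHomologyHecke (p ^ 2 * M),
      periodMapLattice (p ^ 2 * M) f (θ₀ • x) = c • periodMapLattice (p ^ 2 * M) f x) :
    MultOneHyp ℤ_[p] p M hpM f := by
  haveI : Invertible (12 : ℤ_[p]) := (isUnit_twelve p hp5).invertible
  exact multOneHyp_of_intHeckeProjector ℤ_[p] p M hpM f hθ₀ (fun x hx => smul_eq_zero_padicInt_tensor p _ hc x hx)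
    hkill₀ hscale₀

omit [NeZero M] [NeZero (p ^ 2 * M)] [Fintype (diagTorus (ZMod p))] [Invertible (Fintype.card (diagTorus (ZMod p)) : ℤ_[p])] hp in
/-- **K from modularity, an INTEGRAL Hecke quasi-projector for `f_E` on `H₁(X₀(N), ℤ)`, and the integral tame-type carrier
functional.**  The
conclusion is the route decl `TwistedPeriodLatticeSaturation` VERBATIM; BSD is not proved by this, K only CONDITIONALLY on the
three hypotheses described in the module docstring.  Proof: as `KOfCarrier.twistedPeriodLatticeSaturation_of_carrier` (split
`N(W) = p²M`, `Fintype`/unit bookkeeping for `T̃(ℤ/p)`, residue field `ℤ/p`), with `MultOneHyp` supplied by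
`multOneHyp_of_intHeckeProjector_padicInt`. [cite: EdixhovenManin1991, §4] [cite: AshStevens1986, §1 (1.2)–(1.4)]
[cite: EmertonGeeSavitt2015, Lemma 4.1.1] -/
theorem twistedPeriodLatticeSaturation_of_intHeckeProjector (hnf : exists_isNewformOf)
    (hprojZ : ∀ (N p : ℕ) [NeZero N] [Fact p.Prime] (W : WeierstrassCurve ℚ) [W.IsElliptic] [W.IsGloballyMinimal],
      W.conductorNorm ℤ = N → ∀ D : ModularParametrizationData W N, p ^ 2 ∣ N → 11 ≤ p →
      ∃ (θ₀ : HeckeRing0 N 2) (c : ℤ), θ₀ ∈ Algebra.adjoin ℤ (heckeIntGenSet N p) ∧ c ≠ 0 ∧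
        (∀ x : periodHomologyHecke N, periodMapLattice N D.f x = 0 → θ₀ • x = 0) ∧
        ∀ x : periodHomologyHecke N, periodMapLattice N D.f (θ₀ • x) = c • periodMapLattice N D.f x)
    (hcar : ∀ (p M : ℕ) [Fact p.Prime] [NeZero M] [NeZero (p ^ 2 * M)] (hpM : Nat.Coprime p M)
      [Fintype (diagTorus (ZMod p))] [Invertible (Fintype.card (diagTorus (ZMod p)) : ℤ_[p])]
      (W : WeierstrassCurve ℚ) [W.IsElliptic] [W.IsGloballyMinimal], W.conductorNorm ℤ = p ^ 2 * M →
      ∀ D : ModularParametrizationData W (p ^ 2 * M), 11 ≤ p → Rank1Residual.Addv W p → Rank1Residual.Irr W p →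
      Summit.BirchSwinnertonDyer.Rank1Residual.Additive.TypeGOrd W p → padicValInt p W.minimalDiscriminantInt ≤ 4 →
      ∃ (b m : ℕ) (Ψ : spreadLattice ℤ_[p] p M hpM D.f →ₗ[ℤ_[p]] (Option (ZMod p) → ℤ_[p])),
        0 < b ∧ 2 * b < p - 1 ∧
        IsEquivariantOnSpread ℤ_[p] p M hpM D.f
          (coordRep (Kato2004.teichmullerChar p ^ (p - 1 - b)) (Kato2004.teichmullerChar p ^ b)) Ψ ∧
        (∀ v : Option (ZMod p) → ℤ_[p], (p : ℤ_[p]) ^ m • v ∈ LinearMap.range Ψ) ∧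
        ∀ Λ' : Subrepresentation (coordRep (Kato2004.teichmullerChar p ^ (p - 1 - b)) (Kato2004.teichmullerChar p ^ b)),
          Λ'.toSubmodule = LinearMap.range Ψ →
            @ReductionSocleLe p _ (ZMod p) _ _ (PadicInt.toZMod (p := p)).toAlgebra
              (Kato2004.teichmullerChar p ^ (p - 1 - b)) (Kato2004.teichmullerChar p ^ b) (2 * b) Λ') :
    Summit.BirchSwinnertonDyer.BirchSwinnertonDyer.Theses.TeichmullerTwistDescent.TwistedPeriodLatticeSaturation := by
  intro W _ _ p hp _ D hsq hp11 hadd hirr hGo hV4 hopt χ hχ hprim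
  suffices aux : ∀ (N : ℕ) [NeZero N] (_hNN : W.conductorNorm ℤ = N) (D : ModularParametrizationData W N)
      (hsq : p ^ 2 ∣ N), (∀ z ∈ D.L.lattice, ∃ w ∈ periodLattice D.f, z = D.c * w) →
      ∀ z ∈ periodLattice D.f, ∃ w ∈ periodLattice (charTwist N (dvd_refl _) hsq hχ D.f),
        z = gaussSum χ (ZMod.stdAddChar (N := p)) * w from aux _ rfl D hsq hopt
  intro N _ hNN D' hsq' hopt'
  obtain ⟨M, hM, hpM⟩ := conductorNorm_eq_sq_mul_coprime W p (by omega) (hNN ▸ hsq')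
  obtain rfl : N = p ^ 2 * M := hNN.symm.trans hM
  haveI : NeZero M := ⟨fun h => NeZero.ne (p ^ 2 * M) (by rw [h, mul_zero])⟩
  haveI : Fintype (diagTorus (ZMod p)) := Fintype.ofFinite _
  haveI : Invertible (Fintype.card (diagTorus (ZMod p)) : ℤ_[p]) := (isUnit_card_diagTorus p).invertible
  letI : Algebra ℤ_[p] (ZMod p) := (PadicInt.toZMod (p := p)).toAlgebra
  have hsurj : Surjective (algebraMap ℤ_[p] (ZMod p)) := ZMod.ringHom_surjective _
  have halg : ∀ x : ℤ_[p], algebraMap ℤ_[p] (ZMod p) x = ZMod.castHom (dvd_refl p) (ZMod p) (PadicInt.toZMod x) := fun x => by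
    rw [ZMod.castHom_self, RingHom.id_apply]; rfl
  obtain ⟨b, m, Ψ, hb, hb2, hΨ, hm, hsoc⟩ := hcar p M hpM W hM D' hp11 hadd hirr hGo hV4
  obtain ⟨θ₀, c, hθ₀, hc, hkill₀, hscale₀⟩ := hprojZ (p ^ 2 * M) p W hM D' (dvd_mul_right _ _) hp11
  exact saturation_at_of_carrier_of_multOne p M hpM hnf W hM D' hp11 hadd hirr hGo hV4 hopt' χ hχ hprim hsurj halg hb hb2 Ψ hΨ
    hm hsoc (multOneHyp_of_intHeckeProjector_padicInt p M hpM (by omega) D'.f hθ₀ hc hkill₀ hscale₀)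

end Summit.BirchSwinnertonDyer.BirchSwinnertonDyer.Theorems.TeichmullerTwistDescent.KOfIntHeckeProjector
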